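import Summits.BirchSwinnertonDyer.Rank1Residual.Additive.CyclotomicTowerLocalTorsionTop
import Summits.BirchSwinnertonDyer.Rank1Residual.Additive.GoodSupersingularPadicModel
import HarnessLib

/-!
# GLOBAL torsion over the tower from ONE place: `E(K₀K_n)[p^∞] = E(K₀K_∞)[p^∞] = 0`, i.e.
# `E[p^∞]^{Gal(K̄/K₀K_∞)} = 0`, for a good supersingular prime `p ≥ 3` — the vanishing behind the
# injectivity of the bottom-layer control map (Kobayashi Lemma 9.1 / inflation–restriction), from the
# LOCAL theorems of files 6/8/10 (cell `b2b-bsdres`, CLASS-CLOSURE lane, class O10 — x1b GEN 32, class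
# lead; file 12 of the local series)

HONEST FRAMING (cell `b2b-bsdres`, run/shared/lean/b2b/bsd-rank1-residual/, verbatim in every
file): the goal of the cell is to DELETE the COMBINATION-SHAPED residual classes of the
Birch–Swinnerton-Dyer formula for ALL analytic-rank `≤ 1` elliptic curves over `ℚ` — "full BSD
formula for every rank `≤ 1` curve in class `C`" assembled STRICTLY from published theorems — so
that the rank-`≤ 1` remainder becomes exactly the CONSTRUCTION-SHAPED classes, which are TYPED
(missing-input `Prop`s), NOT attempted. This is not "finishing BSD". CLASS-CLOSURE lane: prove
what is provable now; shrink each hard class to its core with data; no claim beyond stated classes;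
research routes on CONSTRUCTION-SHAPED X12 / O10; census / instrument output = EVIDENCE / conjecture
items, NEVER a Literature fact; `RESIDUAL-MAP.md` marks change only by signed lines. THIS FILE:
TOOL THEOREMS ONLY (global points inject equivariantly into local points, `pointsMapOfEmb_smul`) —
no definition, no named Literature fact, no Summits-side fact `def`, no `sorry`, axioms standard;
nothing is booked; no label / mark / count / sub-cell moves; O10 stays OPEN / CONSTRUCTION-SHAPED;
nothing about `BSD(W, p)` of any pair is claimed.

## What is proved

* `pointsMapOfEmb_mem_localFixedPointsOfEmb` — a point of `E(K̄)` fixed by `H ≤ Γ_K` maps under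
  `ι_*` to a point of `E(K̄_E)` fixed by the local subgroup `H_E` (equivariance `pointsMapOfEmb_smul`).
* `eq_zero_of_pow_smul_eq_zero_of_forall_smul_eq_of_local` — LOCAL-TO-GLOBAL: if the `H_E`-fixed local
  points have no `p`-power torsion, neither have the `H`-fixed global points (`ι_*` is injective).
* **`fixedPoints_towerTopSubgroup_geomPrimaryTorsion_eq_bot_padic`** — `E = ℚ_p`, `K₀/K` Galois with
  `[Γ_K : Gal(K̄/K₀)] < (p² − 1)/2`, `p ≥ 3`, `W/K` with a good supersingular `ℤ_p`-model at the place
  of `ι`: **`E[p^∞]^{Gal(K̄/K₀K_∞)} = 0`** (file 10's `E(K_{∞,w})[p^∞] = 0` pulled back); the layer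
  form `eq_zero_of_prime_pow_smul_eq_zero_of_forall_towerSubgroup_smul_eq_padic` (`E(K₀K_n)[p^∞] = 0`
  on `E(K̄)`); `…_of_goodSupersingular` binder forms (`V/ℚ` globally minimal, good at `p`, `a_p = 0`).
  For Kobayashi (`K = ℚ`, `K₀ = ℚ(μ_p)`): `E(ℚ(μ_{p^∞}))[p^∞] = 0` for `E` good supersingular at
  `p ≥ 3` — the input of [K] Lemma 9.1 (restriction `Sel(E/K_n) → Sel(E/K_∞)` injective) and of the
  inflation–restriction isomorphism in the bottom-layer control count.

References: [Kobayashi2003] Prop. 8.7 (p. 16), Lemma 9.1 (p. 25); [GreenbergLNM1716] §3 (p. 85: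
restriction kernels `H¹(K_∞/K_n, E(K_∞)[p^∞])`); [SerreGaloisCohomology1997] II.§1.1.
-/

noncomputable section

open scoped Classical

universe u

namespace Summit.BirchSwinnertonDyer.Rank1Residual.Additive

open Literature.NumberTheory.EllipticCurves Literature.NumberTheory.GaloisRepresentations
  Literature.NumberTheory.EllipticCurves.Kobayashi2003 ZpExtension WeierstrassCurve

/-! ## §1 Global fixed points map to local fixed points -/

section LocalGlobal

variable {K : Type u} [Field K] {E : Type u} [Field E] [Algebra K E]
  (ι : AlgebraicClosure K →ₐ[K] AlgebraicClosure E) (W : WeierstrassCurve K)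

/-- A point of `E(K̄)` fixed by `H ≤ Γ_K` maps under `ι_*` into `E(L_w)` = the points of `E(K̄_E)`
fixed by `H_E = (Γ_E → Γ_K)⁻¹(H)` (`pointsMapOfEmb_smul`). Serre, *Galois Cohomology*, II.§1.1.
[cite: SerreGaloisCohomology1997, II.§1.1] -/
theorem pointsMapOfEmb_mem_localFixedPointsOfEmb (H : Subgroup (Field.absoluteGaloisGroup K))
    {P : geomPoints W} (hP : ∀ σ ∈ H, σ • P = P) :
    pointsMapOfEmb W ι P ∈ localFixedPointsOfEmb ι W H := by
  rw [mem_localFixedPointsOfEmb_iff]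
  intro τ hτ
  rw [← pointsMapOfEmb_smul, hP _ ((mem_localSubgroupOfEmb_iff H ι τ).mp hτ)]

/-- **Local-to-global for torsion**: if the `H_E`-fixed points of `E(K̄_E)` have no `q`-power torsion,
then neither have the `H`-fixed points of `E(K̄)` (`ι_*` is injective). [folklore] -/
theorem eq_zero_of_pow_smul_eq_zero_of_forall_smul_eq_of_local (H : Subgroup (Field.absoluteGaloisGroup K))
    {q k : ℕ} (hloc : ∀ Q ∈ localFixedPointsOfEmb ι W H, q ^ k • Q = 0 → Q = 0)
    {P : geomPoints W} (hP : ∀ σ ∈ H, σ • P = P) (hq : q ^ k • P = 0) : P = 0 := by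
  apply pointsMapOfEmb_injective W ι
  rw [map_zero]
  refine hloc _ (pointsMapOfEmb_mem_localFixedPointsOfEmb ι W H hP) ?_
  rw [← map_nsmul, hq, map_zero]

end LocalGlobal

/-! ## §2 At `E = ℚ_p`: `E(K₀K_n)[p^∞] = E(K₀K_∞)[p^∞] = 0` for good supersingular `p ≥ 3` -/

section Padic

variable {p : ℕ} [hp : Fact p.Prime] {K : Type} [Field K] [Algebra K ℚ_[p]] (κ : ZpExtension K p)
  (K₀ : Type) [Field K₀] [NumberField K₀] [Algebra K K₀] [(galRange (K := K) K₀).Normal]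
  (ι : AlgebraicClosure K →ₐ[K] AlgebraicClosure ℚ_[p]) (W : WeierstrassCurve K) [W.IsElliptic]

omit [NumberField K₀] in
include ι in
/-- **`E(K₀K_n)[p^∞] = 0` on `E(K̄)`** (`E = ℚ_p`, `K₀/K` Galois of index `< (p² − 1)/2`, `p ≥ 3`,
good supersingular `ℤ_p`-model at the place of `ι`): a point of `E(K̄)` fixed by `Gal(K̄/K₀K_n)` and
killed by `p^k` is `0` (file 6 at the place of `ι` + §1). [cite: Kobayashi2003, Prop. 8.7 (p. 16)] -/
theorem eq_zero_of_prime_pow_smul_eq_zero_of_forall_towerSubgroup_smul_eq_padic (hp2 : p ≠ 2)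
    (M : WeierstrassCurve ℤ_[p]) (hΔ : IsUnit M.Δ)
    (hA : M.hasseCoeff p ∈ IsLocalRing.maximalIdeal ℤ_[p])
    (hWM : M.baseChange (AlgebraicClosure ℚ_[p]) = W.baseChange (AlgebraicClosure ℚ_[p]))
    (hK₀0 : (galRange (K := K) K₀).index ≠ 0) (hK₀ : (galRange (K := K) K₀).index < (p ^ 2 - 1) / 2)
    (n k : ℕ) {P : geomPoints W} (hP : ∀ σ ∈ towerSubgroup κ K₀ n, σ • P = P)
    (hq : p ^ k • P = 0) : P = 0 :=
  eq_zero_of_pow_smul_eq_zero_of_forall_smul_eq_of_local ι W (towerSubgroup κ K₀ n)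
    (eq_zero_of_prime_pow_smul_eq_zero_localFixedPointsOfEmb_towerSubgroup_padic κ K₀ ι W hp2 M hΔ hA
      hWM hK₀0 hK₀ n k) hP hq

include ι in
/-- **`E[p^∞]^{Gal(K̄/K₀K_∞)} = 0`** (`E = ℚ_p`, `K₀/K` Galois of index `< (p² − 1)/2`, `p ≥ 3`, good
supersingular `ℤ_p`-model at the place of `ι`): the fixed points of `towerTopSubgroup κ K₀` on the
`p`-primary torsion `E[p^∞] ⊆ E(K̄)` are trivial (file 10 at the place of `ι` + §1). For Kobayashi:
`E(ℚ(μ_{p^∞}))[p^∞] = 0` — the vanishing behind [K] Lemma 9.1 and the inflation–restriction step of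
the bottom-layer control. [cite: Kobayashi2003, Prop. 8.7 (p. 16), Lemma 9.1 (p. 25)]
[cite: GreenbergLNM1716, §3] -/
theorem fixedPoints_towerTopSubgroup_geomPrimaryTorsion_eq_bot_padic (hp2 : p ≠ 2)
    (M : WeierstrassCurve ℤ_[p]) (hΔ : IsUnit M.Δ)
    (hA : M.hasseCoeff p ∈ IsLocalRing.maximalIdeal ℤ_[p])
    (hWM : M.baseChange (AlgebraicClosure ℚ_[p]) = W.baseChange (AlgebraicClosure ℚ_[p]))
    (hK₀0 : (galRange (K := K) K₀).index ≠ 0) (hK₀ : (galRange (K := K) K₀).index < (p ^ 2 - 1) / 2) :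
    FixedPoints.addSubgroup (towerTopSubgroup κ K₀) (geomPrimaryTorsion W p) = ⊥ := by
  rw [eq_bot_iff]
  intro m hm
  rw [AddSubgroup.mem_bot]
  rw [FixedPoints.mem_addSubgroup] at hm
  obtain ⟨k, hk⟩ := m.2
  have hP : ∀ σ ∈ towerTopSubgroup κ K₀, σ • ((m : geomPrimaryTorsion W p) : geomPoints W) =
      ((m : geomPrimaryTorsion W p) : geomPoints W) := by
    intro σ hσ
    have h := hm ⟨σ, hσ⟩
    rw [Subgroup.mk_smul] at h
    rw [← primaryComponent.coe_smul, h]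
  have h0 : ((m : geomPrimaryTorsion W p) : geomPoints W) = 0 :=
    eq_zero_of_pow_smul_eq_zero_of_forall_smul_eq_of_local ι W (towerTopSubgroup κ K₀)
      (eq_zero_of_prime_pow_smul_eq_zero_localFixedPointsOfEmb_towerTopSubgroup_padic κ K₀ ι W hp2 M
        hΔ hA hWM hK₀0 hK₀ k) hP hk
  exact Subtype.ext h0

variable [NumberField K] [IsGalois K K₀]

include ι in
/-- **`E[p^∞]^{Gal(K̄/K₀K_∞)} = 0` for a globally minimal good supersingular `V/ℚ` read over `K`**
(`W ⊗ ℚ̄_p = V ⊗ ℚ̄_p`, `V.HasGoodReductionAtPrime p`, `V.frobeniusTrace p = 0`, `K₀/K` Galois of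
degree `< (p² − 1)/2`, `p ≥ 3`) — NO torsion / model hypothesis (file 8's
`exists_goodSupersingularPadicModel`). [cite: Kobayashi2003, Prop. 8.7 (p. 16), Lemma 9.1 (p. 25)] -/
theorem fixedPoints_towerTopSubgroup_geomPrimaryTorsion_eq_bot_of_goodSupersingular (hp2 : p ≠ 2)
    (V : WeierstrassCurve ℚ) [V.IsElliptic] [V.IsGloballyMinimal]
    (hgood : V.HasGoodReductionAtPrime p) (hap : V.frobeniusTrace p = 0)
    (hWV : W.baseChange (AlgebraicClosure ℚ_[p]) = V.baseChange (AlgebraicClosure ℚ_[p]))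
    (hK₀ : Module.finrank K K₀ < (p ^ 2 - 1) / 2) :
    FixedPoints.addSubgroup (towerTopSubgroup κ K₀) (geomPrimaryTorsion W p) = ⊥ := by
  obtain ⟨M, hΔ, hA, hVM⟩ := exists_goodSupersingularPadicModel hp2 V hgood hap
  obtain ⟨hK₀0, hK₀'⟩ := index_galRange_ne_zero_and_lt (p := p) K₀ hK₀
  exact fixedPoints_towerTopSubgroup_geomPrimaryTorsion_eq_bot_padic κ K₀ ι W hp2 M hΔ hA
    (hVM.trans hWV.symm) hK₀0 hK₀'

include ι in
/-- **`E(K₀K_n)` has no `p`-power torsion, for a globally minimal good supersingular `V/ℚ` read over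
`K`** (same hypotheses; points of `E(K̄)` fixed by `Gal(K̄/K₀K_n)`).
[cite: Kobayashi2003, Prop. 8.7 (p. 16)] -/
theorem eq_zero_of_prime_pow_smul_eq_zero_of_forall_towerSubgroup_smul_eq_of_goodSupersingular
    (hp2 : p ≠ 2) (V : WeierstrassCurve ℚ) [V.IsElliptic] [V.IsGloballyMinimal]
    (hgood : V.HasGoodReductionAtPrime p) (hap : V.frobeniusTrace p = 0)
    (hWV : W.baseChange (AlgebraicClosure ℚ_[p]) = V.baseChange (AlgebraicClosure ℚ_[p]))
    (hK₀ : Module.finrank K K₀ < (p ^ 2 - 1) / 2) (n k : ℕ) {P : geomPoints W}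
    (hP : ∀ σ ∈ towerSubgroup κ K₀ n, σ • P = P) (hq : p ^ k • P = 0) : P = 0 := by
  obtain ⟨M, hΔ, hA, hVM⟩ := exists_goodSupersingularPadicModel hp2 V hgood hap
  obtain ⟨hK₀0, hK₀'⟩ := index_galRange_ne_zero_and_lt (p := p) K₀ hK₀
  exact eq_zero_of_prime_pow_smul_eq_zero_of_forall_towerSubgroup_smul_eq_padic κ K₀ ι W hp2 M hΔ hA
    (hVM.trans hWV.symm) hK₀0 hK₀' n k hP hq

end Padic

end Summit.BirchSwinnertonDyer.Rank1Residual.Additive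

end
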